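import Summits.HodgeConjecture.HodgeConjecture.Theorems.KummerModuliInvariantsByMarkmanOnM
import Literature.AlgebraicGeometry.Hyperkaehler.GeneralizedKummerTypeTranslationActionOnCohomology
import Literature.AlgebraicGeometry.HodgeTheory.VanishingCohomologyNontrivialProofs
import Summits.Ventures.HodgeKum4.Theorems.KummerFixedLocusMotivicBookkeepingSplit
import Summits.Ventures.HodgeKum4.Theorems.KummerFixedLocusOrbitSpan
import Mathlib.RepresentationTheory.Invariants
import HarnessLib
import HarnessLib.Audit

/-!
# KummerModuliPrimeLevelAssembly — at prime level `n + 1`, the Hodge conjecture for the Kummer moduli space `K_H(v)` (and all its powers) follows from NAMED facts plus ONE explicit open input, the fixed-component Gram datum at `K`; and the EXACT REACH of the Markman∕Bülles-on-`M` mechanism (kernel theorems; nothing asserted)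

Summit `HodgeConjecture/HodgeConjecture`; seat `vhodge-19149-w3`; sequel of
`Theorems/KummerModuliInvariantsByMarkmanOnM.lean` (the `Γ(K)`-invariant half of "`K_H(v)` is dominated by the
powers of `A`", from T1 `Yoshioka2001_kummerFibre_restrictionImage` + Bülles).  FILING ANCHOR `--supports
stmt-HodgeConjecture-19149` (director's instruction); MATHEMATICAL TARGET = the `K_H(v)` rung
`Theorems.HC_KummerSheafModuliSpace` ∕ `Theorems.KummerSheafModuliSpace_dominatedByAbelianSurface`; NO bearing on
Weil sixfolds.  HONEST FRAMING: every theorem is proved in the kernel from NAMED hypotheses — T1, Bülles,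
`Hyperkaehler.Foster2024_translationAction_kumType`, `Hyperkaehler.FloccariVaresco2024_autFixingH2H3_equiv_kumType`,
`HodgeTheory.Arapura2006_hodgeClasses_algebraic_of_isDominatedByPowers` — and, in §3, ONE explicit OPEN geometric
hypothesis `hI` (the Gram datum "T5 = I(n)" of the crux idea `kummer-moduli-invariants-by-markman-on-m` AT the
variety: an algebraic middle class `w` and a functional `φ` with `φ(ρ(g)w) = 1` for `1 ≠ g ∈ Γ(K)` and `φ(w) ≠ 1`;
intended `w = cl(W)`, `W` the top fixed component of the Kummer involution, `φ = ∫ w ∪ ·`; the text of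
`Summit.Ventures.HodgeKum4.Kum4FixedFourfoldClasses` at `n = 4`; OPEN for `n ≥ 6`, never a fact, never a theorem).
Nothing here asserts `HodgeConjecture`, `HC_AV`, `W₆`, `HC_Kum4Type`, `HC_KummerSheafModuliSpace` or the Hodge
conjecture for any single `K_H(v)`.

## What is proved (K = kernel)

§3 PRIME-LEVEL ASSEMBLY.  `coinvariantsKer_le_algebraicClasses_of_gram` (one variety, `n + 1` prime): the
`Γ`-NON-invariant middle classes lie in the span of the `Γ`-orbit of `w`, hence are algebraic — Foster's bound
`dim 𝒦 ≤ (n+1)⁴ − 1` (`….finrank_coinvariantsKer_le`), `|Γ| = (n+1)⁴` (Floccari–Varesco `card_eq`) and the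
tree's orbit-span lemma `Summit.Ventures.HodgeKum4.OrbitSpan.coinvariantsKer_le_span_orbit` (the `n`-indexed
text of route №1's `kum4NonInvariantClassesAlgebraic_of`).  `isDominatedByPowers_of_gram` ∕
`hodgeConjectureFor_of_gram`: for `K = K_H(v)` of `Kumⁿ`-type with `n + 1` prime, `hI` ⟹
`IsDominatedByPowers (2n) K 2 A` ⟹ (Arapura + the tree's THEOREM `HC(Aᵏ)` for abelian surfaces, inside
`IsKummerSheafModuliSpace.hodgeConjectureFor_of_isDominatedByPowers`) the Hodge conjecture for `K` and all its
powers.  Mechanism: `c = avg(c) + (c − avg(c))`; the Reynolds average is `Γ`-invariant, dominated by the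
prequel's §2; `c − avg(c) ∈ 𝒦` is zero off the middle degree (Foster (ii)) and algebraic in it, hence
dominated (`algebraicClassesDominated_holds`).  `hc_kummerSheafModuliSpace_primeLevel_of_gram`: the same for
all prime levels at once.
§4 EXACT REACH.  `dominatedByAbelianSurface_iff_coinvariantsKer_le`: modulo T1 + Bülles + Floccari–Varesco, the
typed open question `Theorems.KummerSheafModuliSpace_dominatedByAbelianSurface` is EQUIVALENT to the domination
of the `Γ(K)`-non-invariant classes alone; `isDominatedByPowers_iff_middle_coinvariantsKer_le`: at prime level,
to the single inclusion `𝒦(H^{2n}(K)) ⊆ dominatedClasses`.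

## What this is NOT

Not a proof of HC for any `K_H(v)` (`hI` open for `n ≥ 6`; `n = 2` Hassett–Tschinkel 2013 in print; `n = 4` =
the kum4 cell's residual I1geo on every `Kum⁴`-type `X`, inside route №1's cone).  Composite levels `n + 1` are
not touched by §3.  No new definition, no new named fact.
-/

noncomputable section

open CategoryTheory MonoidalCategory
open Literature.AlgebraicTopology.SingularHomology
open Literature.AlgebraicGeometry Literature.AlgebraicGeometry.HodgeTheory
  Literature.AlgebraicGeometry.Hyperkaehler Literature.AlgebraicGeometry.ModuliOfSheaves
open Literature.AlgebraicGeometry.Motives (SchemeOver AbelianVariety IsSmoothProjective ComplexPoints fiberOver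
  fiberι)

-- `Summit.<Summit>.<Problem>` is the mandated summit-side namespace (CONVENTIONS §2); for the
-- single-conjunct summit `HodgeConjecture` the two coincide, so the duplicate is deliberate.
set_option linter.dupNamespace false

namespace Summit.HodgeConjecture.HodgeConjecture.Theorems.KummerModuliMarkmanOnM

variable {n : ℕ} {A : AbelianVariety ℂ} {K : SchemeOver ℂ}

/-! ### §3  PRIME-LEVEL ASSEMBLY: `K_H(v)` is dominated by the powers of `A`, hence satisfies the Hodge conjecture with all its powers, modulo the ONE open input `hI` -/

/-- Translates `ρ(g) w = (g⁻¹)^* w` of an algebraic class are algebraic. [cite: Fulton1998, §19.1] -/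
theorem translationRep_mem_algebraicClasses {X : SchemeOver ℂ} {w : complexBetti X (2 * n)}
    (hw : w ∈ algebraicClasses X n) (g : autFixingH2H3 X) :
    translationRep X (2 * n) g w ∈ algebraicClasses X n :=
  (mem_algebraicClasses_map_iff_of_iso (p := n) ((g⁻¹ : autFixingH2H3 X).val) (c := w)).2 hw

/-- **The `Γ(K)`-NON-invariant middle classes lie in the span of the orbit of the Gram class, hence are
algebraic** (`n + 1` prime): Foster's bound `dim 𝒦 ≤ (n+1)⁴ − 1`, `|Γ(K)| = (n+1)⁴` (Floccari–Varesco) and the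
tree's orbit-span lemma.  The `n`-indexed text of route №1's `kum4NonInvariantClassesAlgebraic_of`, at one
variety. [cite: Foster2024, Remark 88] [cite: FloccariVaresco2024, §3] [cite: HassettTschinkel2013, Prop. 4.3 (the model, n = 2)] -/
theorem coinvariantsKer_le_algebraicClasses_of_gram (hF : Foster2024_translationAction_kumType)
    (hFV : FloccariVaresco2024_autFixingH2H3_equiv_kumType) (hn : 2 ≤ n) (hp : (n + 1).Prime)
    {X : SchemeOver ℂ} (hX : IsSmoothProjective (2 * n) X) (hKum : IsOfGeneralizedKummerType n X)
    (hI : ∃ (w : complexBetti X (2 * n)) (φ : complexBetti X (2 * n) →ₗ[ℂ] ℂ), w ∈ algebraicClasses X n ∧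
      (∀ g : autFixingH2H3 X, g ≠ 1 → φ (translationRep X (2 * n) g w) = 1) ∧ φ w ≠ 1) :
    Representation.Coinvariants.ker (translationRep X (2 * n)) ≤ algebraicClasses X n := by
  -- adapted from run/shared/lean/pub/vhodge/memos/OQH3-g2-Restate.lean §C (vhodge-oqh-3 g2)
  obtain ⟨w, φ, hw, hφ, hw1⟩ := hI
  have hcard : Nat.card (autFixingH2H3 X) = (n + 1) ^ 4 := hFV.card_eq hn hX hKum
  haveI : Finite (autFixingH2H3 X) := Nat.finite_of_card_ne_zero (by rw [hcard]; positivity)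
  letI : Fintype (autFixingH2H3 X) := Fintype.ofFinite _
  haveI : Module.Finite ℂ (complexBetti X (2 * n)) := finite_complexBetti hX (2 * n)
  have hcard' : Fintype.card (autFixingH2H3 X) = (n + 1) ^ 4 := by
    rw [← Nat.card_eq_fintype_card]; exact hcard
  have hpos : 1 ≤ (n + 1) ^ 4 := Nat.one_le_pow _ _ (Nat.succ_pos n)
  have hdim := hF.finrank_coinvariantsKer_le hFV hn hp hX hKum
  refine (Summit.Ventures.HodgeKum4.OrbitSpan.coinvariantsKer_le_span_orbit (translationRep X (2 * n)) w φ 1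
    hφ hw1 (by rw [hcard']; omega)).trans ?_
  rw [Submodule.span_le]
  rintro _ ⟨g, rfl⟩
  exact translationRep_mem_algebraicClasses hw g

/-- **ASSEMBLY, domination form: at prime level `n + 1`, the Gram datum at `K = K_H(v)` implies that `K` is
dominated by the powers of its abelian surface** — the instance at `K` of
`Theorems.KummerSheafModuliSpace_dominatedByAbelianSurface`, from T1 + Bülles (§2) + Foster + Floccari–Varesco +
`algebraicClassesDominated_holds` + `hI`.  (`c = avg(c) + (c − avg(c))`: the average is `Γ`-invariant, hence
dominated by §2; the rest is in `𝒦`, zero off the middle degree (Foster (ii)) and algebraic in it.)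
[cite: Yoshioka2001AbelianSurfaces, §4.1] [cite: Bulles2020, Thm. 0.1] [cite: Foster2024, Lemma 85 and Remark 88]
[cite: FloccariVaresco2024, §3] -/
theorem isDominatedByPowers_of_gram (hY : Yoshioka2001_kummerFibre_restrictionImage)
    (hB : Bulles2020_sheafModuli_isDominatedByPowers_surface) (hF : Foster2024_translationAction_kumType)
    (hFV : FloccariVaresco2024_autFixingH2H3_equiv_kumType) (hn : 2 ≤ n) (hp : (n + 1).Prime)
    (hKv : IsKummerSheafModuliSpace n A K)
    (hI : ∃ (w : complexBetti K (2 * n)) (φ : complexBetti K (2 * n) →ₗ[ℂ] ℂ), w ∈ algebraicClasses K n ∧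
      (∀ g : autFixingH2H3 K, g ≠ 1 → φ (translationRep K (2 * n) g w) = 1) ∧ φ w ≠ 1) :
    IsDominatedByPowers (2 * n) K 2 A.X := by
  -- adapted from run/shared/lean/pub/vhodge/memos/OQH3-g2-Restate.lean §C (vhodge-oqh-3 g2), `h5 := §2`
  have hK := hKv.isSmoothProjective
  have hKum := hKv.isOfGeneralizedKummerType
  have hAX : IsSmoothProjective 2 A.X := Motives.isSmoothProjective_of_dim_eq' hKv.dim_eq
  intro k
  change Summit.Ventures.HodgeKum4.dominatedClasses (2 * n) K 2 A.X k = ⊤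
  rw [eq_top_iff]
  rintro c -
  have hcard : Nat.card (autFixingH2H3 K) = (n + 1) ^ 4 := hFV.card_eq hn hK hKum
  haveI : Finite (autFixingH2H3 K) := Nat.finite_of_card_ne_zero (by rw [hcard]; positivity)
  letI : Fintype (autFixingH2H3 K) := Fintype.ofFinite _
  haveI : Invertible (Fintype.card (autFixingH2H3 K) : ℂ) :=
    invertibleOfNonzero (Nat.cast_ne_zero.2 Fintype.card_ne_zero)
  have hsplit : c = (translationRep K k).averageMap c + (c - (translationRep K k).averageMap c) := by abel
  rw [hsplit]
  refine add_mem (invariants_translationRep_le_dominatedClasses hY hB hn hKv k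
    ((translationRep K k).averageMap_invariant c)) ?_
  have hmem : c - (translationRep K k).averageMap c ∈ Representation.Coinvariants.ker (translationRep K k) :=
    Summit.Ventures.HodgeKum4.OrbitSpan.sub_averageMap_mem_coinvariantsKer _ c
  by_cases hk : k = 2 * n
  · subst hk
    exact Summit.Ventures.HodgeKum4.algebraicClassesDominated_holds hK hAX n
      (coinvariantsKer_le_algebraicClasses_of_gram hF hFV hn hp hK hKum hI hmem)
  · rw [hF.coinvariantsKer_eq_bot_of_ne hn hp hK hKum hk, Submodule.mem_bot] at hmem
    rw [hmem]
    exact Submodule.zero_mem _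

/-- **ASSEMBLY, Hodge form: at prime level `n + 1`, the Gram datum at `K = K_H(v)` implies the Hodge conjecture
for `K` and for all its powers** — `isDominatedByPowers_of_gram` fed into the tree's reduction
`IsKummerSheafModuliSpace.hodgeConjectureFor_of_isDominatedByPowers` (Arapura 2006 Lemma 4.2 + the THEOREM
`HC(Aᵏ)` for abelian surfaces).  All inputs are NAMED facts except the OPEN `hI`; NOT a proof of the Hodge
conjecture for any `K_H(v)`. [cite: Arapura2006, Lemma 4.2] [cite: Yoshioka2001AbelianSurfaces, §4.1]
[cite: Bulles2020, Thm. 0.1] [cite: Foster2024, Remark 88] [cite: FloccariVaresco2024, §3] -/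
theorem hodgeConjectureFor_of_gram (hA42 : Arapura2006_hodgeClasses_algebraic_of_isDominatedByPowers)
    (hY : Yoshioka2001_kummerFibre_restrictionImage) (hB : Bulles2020_sheafModuli_isDominatedByPowers_surface)
    (hF : Foster2024_translationAction_kumType) (hFV : FloccariVaresco2024_autFixingH2H3_equiv_kumType)
    (hn : 2 ≤ n) (hp : (n + 1).Prime) (hKv : IsKummerSheafModuliSpace n A K)
    (hI : ∃ (w : complexBetti K (2 * n)) (φ : complexBetti K (2 * n) →ₗ[ℂ] ℂ), w ∈ algebraicClasses K n ∧
      (∀ g : autFixingH2H3 K, g ≠ 1 → φ (translationRep K (2 * n) g w) = 1) ∧ φ w ≠ 1) :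
    HodgeConjectureFor (2 * n) K ∧ ∀ m : ℕ, HodgeConjectureFor ((m + 1) * (2 * n)) (K.pow (m + 1)) :=
  hKv.hodgeConjectureFor_of_isDominatedByPowers hA42 (isDominatedByPowers_of_gram hY hB hF hFV hn hp hKv hI)

/-- **ASSEMBLY to the typed rung, prime levels: if the Gram datum holds on every Kummer moduli space of
`Kumⁿ`-type with `n + 1` prime, then `Theorems.HC_KummerSheafModuliSpace` holds AT EVERY PRIME LEVEL** (the rung
itself quantifies over all `n ≥ 2`; composite levels are not touched by this mechanism).
[cite: Arapura2006, Lemma 4.2] [cite: Foster2024, Remark 88] -/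
theorem hc_kummerSheafModuliSpace_primeLevel_of_gram
    (hA42 : Arapura2006_hodgeClasses_algebraic_of_isDominatedByPowers)
    (hY : Yoshioka2001_kummerFibre_restrictionImage) (hB : Bulles2020_sheafModuli_isDominatedByPowers_surface)
    (hF : Foster2024_translationAction_kumType) (hFV : FloccariVaresco2024_autFixingH2H3_equiv_kumType)
    (hI : ∀ (n : ℕ), 2 ≤ n → (n + 1).Prime → ∀ (A : AbelianVariety ℂ) ⦃K : SchemeOver ℂ⦄,
      IsKummerSheafModuliSpace n A K →
        ∃ (w : complexBetti K (2 * n)) (φ : complexBetti K (2 * n) →ₗ[ℂ] ℂ), w ∈ algebraicClasses K n ∧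
          (∀ g : autFixingH2H3 K, g ≠ 1 → φ (translationRep K (2 * n) g w) = 1) ∧ φ w ≠ 1)
    (n : ℕ) (hn : 2 ≤ n) (hp : (n + 1).Prime) (A : AbelianVariety ℂ) ⦃K : SchemeOver ℂ⦄
    (hKv : IsKummerSheafModuliSpace n A K) :
    HodgeConjectureFor (2 * n) K ∧ ∀ m : ℕ, HodgeConjectureFor ((m + 1) * (2 * n)) (K.pow (m + 1)) :=
  hodgeConjectureFor_of_gram hA42 hY hB hF hFV hn hp hKv (hI n hn hp A hKv)

/-! ### §4  EXACT REACH: the open question "`K_H(v)` is dominated by `A`" is equivalent to its `Γ(K)`-NON-invariant half -/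

/-- **EXACT REACH of Markman∕Bülles-on-`M`: modulo T1, Bülles and Floccari–Varesco (`|Γ(K)| = (n+1)⁴`, so
`Γ(K)` is finite and every class is its `Γ`-average plus an element of the augmentation submodule `𝒦`), the
typed open question `Theorems.KummerSheafModuliSpace_dominatedByAbelianSurface` is EQUIVALENT to the domination
of the `Γ(K)`-NON-invariant classes alone** — `𝒦(Hᵏ(K)) ⊆ dominatedClasses (2n) K 2 A k` for every Kummer moduli
space and every degree.  The invariant half is §2; nothing is asserted about either side.
[cite: Floccari2023OG6Motive, §1 (the question)] [cite: FloccariVaresco2024, §3 (|Γ| = (n+1)⁴)]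
[cite: Yoshioka2001AbelianSurfaces, §4.1] [cite: Bulles2020, Thm. 0.1] -/
theorem dominatedByAbelianSurface_iff_coinvariantsKer_le (hY : Yoshioka2001_kummerFibre_restrictionImage)
    (hB : Bulles2020_sheafModuli_isDominatedByPowers_surface)
    (hFV : FloccariVaresco2024_autFixingH2H3_equiv_kumType) :
    KummerSheafModuliSpace_dominatedByAbelianSurface ↔
      ∀ (n : ℕ), 2 ≤ n → ∀ (A : AbelianVariety ℂ) ⦃K : SchemeOver ℂ⦄, IsKummerSheafModuliSpace n A K →
        ∀ k : ℕ, Representation.Coinvariants.ker (translationRep K k) ≤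
          Summit.Ventures.HodgeKum4.dominatedClasses (2 * n) K 2 A.X k := by
  constructor
  · intro h n hn A K hKv k
    have htop : Summit.Ventures.HodgeKum4.dominatedClasses (2 * n) K 2 A.X k = ⊤ := h n hn A hKv k
    rw [htop]
    exact le_top
  · intro h n hn A K hKv k
    change Summit.Ventures.HodgeKum4.dominatedClasses (2 * n) K 2 A.X k = ⊤
    rw [eq_top_iff]
    rintro c -
    have hcard : Nat.card (autFixingH2H3 K) = (n + 1) ^ 4 :=
      hFV.card_eq hn hKv.isSmoothProjective hKv.isOfGeneralizedKummerType
    haveI : Finite (autFixingH2H3 K) := Nat.finite_of_card_ne_zero (by rw [hcard]; positivity)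
    letI : Fintype (autFixingH2H3 K) := Fintype.ofFinite _
    haveI : Invertible (Fintype.card (autFixingH2H3 K) : ℂ) :=
      invertibleOfNonzero (Nat.cast_ne_zero.2 Fintype.card_ne_zero)
    have hsplit : c = (translationRep K k).averageMap c + (c - (translationRep K k).averageMap c) := by abel
    rw [hsplit]
    exact add_mem (invariants_translationRep_le_dominatedClasses hY hB hn hKv k
      ((translationRep K k).averageMap_invariant c))
      (h n hn A hKv k (Summit.Ventures.HodgeKum4.OrbitSpan.sub_averageMap_mem_coinvariantsKer _ c))

/-- **EXACT REACH at prime level `n + 1`, one variety: `K_H(v)` is dominated by the powers of `A` iff its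
`Γ(K)`-non-invariant MIDDLE classes are** (Foster (ii): `𝒦(Hᵏ) = 0` for `k ≠ 2n`).  So at prime levels the
whole open question for `K_H(v)` is the one submodule inclusion `𝒦(H^{2n}(K)) ⊆ dominatedClasses`, which §3
derives from the Gram datum. [cite: Foster2024, Lemma 85 and Remark 88] [cite: FloccariVaresco2024, §3]
[cite: Yoshioka2001AbelianSurfaces, §4.1] [cite: Bulles2020, Thm. 0.1] -/
theorem isDominatedByPowers_iff_middle_coinvariantsKer_le (hY : Yoshioka2001_kummerFibre_restrictionImage)
    (hB : Bulles2020_sheafModuli_isDominatedByPowers_surface) (hF : Foster2024_translationAction_kumType)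
    (hFV : FloccariVaresco2024_autFixingH2H3_equiv_kumType) (hn : 2 ≤ n) (hp : (n + 1).Prime)
    (hKv : IsKummerSheafModuliSpace n A K) :
    IsDominatedByPowers (2 * n) K 2 A.X ↔
      Representation.Coinvariants.ker (translationRep K (2 * n)) ≤
        Summit.Ventures.HodgeKum4.dominatedClasses (2 * n) K 2 A.X (2 * n) := by
  have hK := hKv.isSmoothProjective
  have hKum := hKv.isOfGeneralizedKummerType
  constructor
  · intro h
    have htop : Summit.Ventures.HodgeKum4.dominatedClasses (2 * n) K 2 A.X (2 * n) = ⊤ := h (2 * n)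
    rw [htop]
    exact le_top
  · intro h k
    change Summit.Ventures.HodgeKum4.dominatedClasses (2 * n) K 2 A.X k = ⊤
    rw [eq_top_iff]
    rintro c -
    have hcard : Nat.card (autFixingH2H3 K) = (n + 1) ^ 4 := hFV.card_eq hn hK hKum
    haveI : Finite (autFixingH2H3 K) := Nat.finite_of_card_ne_zero (by rw [hcard]; positivity)
    letI : Fintype (autFixingH2H3 K) := Fintype.ofFinite _
    haveI : Invertible (Fintype.card (autFixingH2H3 K) : ℂ) :=
      invertibleOfNonzero (Nat.cast_ne_zero.2 Fintype.card_ne_zero)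
    have hsplit : c = (translationRep K k).averageMap c + (c - (translationRep K k).averageMap c) := by abel
    rw [hsplit]
    refine add_mem (invariants_translationRep_le_dominatedClasses hY hB hn hKv k
      ((translationRep K k).averageMap_invariant c)) ?_
    have hmem : c - (translationRep K k).averageMap c ∈ Representation.Coinvariants.ker (translationRep K k) :=
      Summit.Ventures.HodgeKum4.OrbitSpan.sub_averageMap_mem_coinvariantsKer _ c
    by_cases hk : k = 2 * n
    · subst hk
      exact h hmem
    · rw [hF.coinvariantsKer_eq_bot_of_ne hn hp hK hKum hk, Submodule.mem_bot] at hmem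
      rw [hmem]
      exact Submodule.zero_mem _

end Summit.HodgeConjecture.HodgeConjecture.Theorems.KummerModuliMarkmanOnM

end
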